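/-
Copyright (c) 2026 the pub-hodgecm-mathlib formalisation cell (harness21).  Prover seat hodgecm-mathlib-F0P3-p01 (g30), «(D-RAM) FOUR-FRAME» road of crux H413, line LH4, MS ROAD A,
STAGE B (LH4-p10 (g2) deal sheet 2026-09-03T23:26:42Z, brick B1 «RESIDUE COUNTS», SPEC-StageB v1 §A), FILE 2 of 2: the UNIT-side residue counts of a ramified quadratic datum.  2026-09-04.
-/
import Literature.NumberTheory.LocalFields.RamifiedQuadraticResidueCounts   -- ★ p855662 (this seat, FILE 1): fixed balls, `relIndex_fixedBall_eq_pow`, `fixedBall_neg_one_eq`, `mem_fixedSubgroup_iff`; brings ★ `ValuationBallStableSubgroupIndex`, ★ `SubgroupIndexDevissage`, ★ `WildQuadraticDatumTrace`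
import HarnessLib

/-!
# Residue counts of a RAMIFIED QUADRATIC DATUM, II (unit side): `[𝒪_E^× : 1 + 𝔭_Eⁿ] = (q − 1)q^{n−1}`, `[𝒪_F^× : 𝒪_F^× ∩ (1 + 𝔭_Eⁿ)] = (q − 1)q^{⌈n∕2⌉ − 1}`, fibre sizes
# (Serre, *Local Fields*, Ch. IV §2 Prop. 6, Ch. II §3 Prop. 5)

Topic `NumberTheory/LocalFields`; namespace `Literature.NumberTheory.LocalFields.WildQuadraticDatum` (one-field datum of ★ `WildQuadraticDatumTrace`; the fixed field `F = K^σ` is never a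
type).  THEOREMS ONLY (no definition, no instance, no notation, no named fact, no `sorry`).  Cell `pub/hodgecm-mathlib` (D-0151), crux H413 = `stmt-HodgeConjecture-24833`; helper lane
`--supports stmt-HodgeConjecture-24833`; MS road A, Stage B (LH4-p10 (g2) SPEC-StageB v1 §A (C3)(C4)(C5)).  No completeness; `[Finite 𝓀[K]]`; `q := Nat.card 𝓀[K]`.

CURRENCY (define-free, MEMBERSHIP LETTERS for the multiplicative side — the consumer supplies its own subgroups of `Kˣ`, e.g. ★ `F0P3cDyRamDiagonalTorusDefs`' tori):
`U` with `u ∈ U ↔ v u = 1` (resp. `σ u = u ∧ v u = 1`), `U_n` with `u ∈ U_n ↔ ‹u ∈ U› ∧ v(u − 1) ≤ exp(−n)`; additive side as in FILE 1 (balls `B(k)`, `Fix = ker(σ − id)`, `B_F(k) = B(k) ⊓ Fix`).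

THE MATHEMATICS.  §1 is the one generic counting lemma behind all unit-residue counts (`relIndex_add_relIndex_eq_of_units`): for additive subgroups `C ≤ A′ ≤ A` of a field with `[A : C] < ∞`
and a subgroup `U ≤ Kˣ` with underlying set `A ∖ A′` acting on `C`, `[U : U_C] + [A′ : A′ ∩ C] = [A : C]` (`U_C = {u | u − 1 ∈ C}`) — unit classes mod `C` are the classes of `A ∕ C` off `A′`.
§2 (C3): `A = 𝒪_E`, `A′ = 𝔭_E`, `C = 𝔭_Eⁿ` and ★ `[B(0) : B(−k)] = q^k` give `[𝒪_E^× : 1 + 𝔭ⁿ] = qⁿ − q^{n−1}`.  §3 (C4): `A = 𝒪_F = B_F(0)`, `A′ = B_F(−2) = B_F(−1)` (parity), `C = B_F(−n)` and ★ FILE 1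
`[B_F(0) : B_F(−n)] = q^{⌈n∕2⌉}` (shifted once by `π₀ = ϖσϖ` for `[B_F(−2) : B_F(−n)]`) give `[𝒪_F^× : 𝒪_F^× ∩ (1 + 𝔭_Eⁿ)] = q^{⌈n∕2⌉} − q^{⌈n∕2⌉−1}`.  §4 (C5): the fibres of `𝒪∕𝔭^N → 𝒪∕𝔭ⁿ` are
cosets of `𝔭ⁿ∕𝔭^N`, of size `[B(−n) : B(−N)] = q^{N−n}` (and consist of units over a unit class) — the «fibre uniformity» used by the per-stratum counts.

* §1 **`relIndex_add_relIndex_eq_of_units`** (generic).   §2 (C3) **`relIndex_unitLevel_add_eq`**, **`relIndex_unitLevel_eq`**.   §3 (C4) `relIndex_fixedBall_neg_two_eq_pow`,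
  **`relIndex_fixedUnitLevel_add_eq`**, **`relIndex_fixedUnitLevel_eq`**.   §4 (C5) `relIndex_ball_ball_eq_pow`.

HONEST LABEL: HC_CM is proved only modulo the 7 printed citations (2 remaining named inputs: hLiu418 = stmt-HodgeConjecture-24832, h413 = stmt-HodgeConjecture-24833) until rung 0
closes; count-neutral brick (elementary group ∕ valuation algebra; nothing printed is asserted).

## References
* [Serre1979] J.-P. Serre, *Local Fields*, GTM 67 (1979), Ch. IV §2 Prop. 6 (`U∕U¹ ≅ 𝓀^×`, `Uⁿ∕Uⁿ⁺¹ ≅ 𝓀`), Ch. II §3 Prop. 5 (indices of `𝔭ⁿ`), Ch. I §6 Prop. 18 (totally ramified: same residue field).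
* [WeilBNT1967] A. Weil, *Basic Number Theory*, Grundlehren 144 (1967), Ch. I §4.
-/

set_option autoImplicit false

open WithZero
open scoped Valued

namespace Literature.NumberTheory.LocalFields.WildQuadraticDatum

open Literature.NumberTheory.Automorphic

/-! ## §1 The generic count: unit classes against additive classes -/

section Generic

variable {K : Type*} [Field K]

/-- **UNIT CLASSES AGAINST ADDITIVE CLASSES (generic, define-free).**  `K` a field; additive subgroups `C ≤ A′ ≤ A` of `K` («level», «non-units», «integers») with `[A : C]` finite; a
subgroup `U ≤ Kˣ` whose underlying set is EXACTLY `A ∖ A′`, acting on `C` by multiplication, and `U_C = {u ∈ U | u − 1 ∈ C}`.  Then `[U : U_C] + [A′ : A′ ∩ C] = [A : C]`: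
the additive class `u + C` of a unit is the multiplicative coset `u·U_C` (`u′ − u ∈ C ⟺ u⁻¹u′ − 1 ∈ C` as `u⁻¹C = C`), the classes of `A ∕ C` met by `U` are exactly those NOT met by `A′`
(`A′ + C = A′`), and `A′ ∕ (A′ ∩ C) ↪ A ∕ C`.  (With `A = 𝒪`, `A′ = 𝔭`, `C = 𝔭ⁿ`: `[𝒪^× : 1 + 𝔭ⁿ] = qⁿ − q^{n−1}`.) [cite: Serre1979, Ch. IV §2 Prop. 6; Ch. II §3 Prop. 5] -/
theorem relIndex_add_relIndex_eq_of_units (A A' C : AddSubgroup K) (hCA' : C ≤ A') (hA'A : A' ≤ A)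
    (U Un : Subgroup Kˣ) (hU : ∀ x : K, (∃ u : Kˣ, u ∈ U ∧ (u : K) = x) ↔ (x ∈ A ∧ x ∉ A'))
    (hUn : ∀ u : Kˣ, u ∈ Un ↔ (u ∈ U ∧ (u : K) - 1 ∈ C))
    (hUC : ∀ u : Kˣ, u ∈ U → ∀ x : K, x ∈ C → (u : K) * x ∈ C) (hfin : C.relIndex A ≠ 0) :
    Un.relIndex U + C.relIndex A' = C.relIndex A := by
  classical
  -- the finite quotient `Q = A ⧸ (C ⊓ A)`
  haveI : (C.addSubgroupOf A).FiniteIndex := ⟨hfin⟩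
  haveI : Finite (A ⧸ C.addSubgroupOf A) := AddSubgroup.finite_quotient_of_finiteIndex
  have hmemA : ∀ u : Kˣ, u ∈ U → (u : K) ∈ A := fun u hu => ((hU u).1 ⟨u, hu, rfl⟩).1
  have hnotA' : ∀ u : Kˣ, u ∈ U → (u : K) ∉ A' := fun u hu => ((hU u).1 ⟨u, hu, rfl⟩).2
  -- `φ : U → Q`
  let φ : U → A ⧸ C.addSubgroupOf A := fun u => QuotientAddGroup.mk ⟨(u : Kˣ), hmemA u u.2⟩
  -- `θ : A' ⧸ (C ⊓ A') → Q`, injective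
  let ι : A' →+ A := AddSubgroup.inclusion hA'A
  have hι : ∀ x : A', x ∈ C.addSubgroupOf A' → ι x ∈ C.addSubgroupOf A := fun x hx => by
    rw [AddSubgroup.mem_addSubgroupOf] at hx ⊢; exact hx
  let θ := QuotientAddGroup.map (C.addSubgroupOf A') (C.addSubgroupOf A) ι hι
  have hθinj : Function.Injective θ := by
    rw [injective_iff_map_eq_zero]
    intro q hq
    induction q using QuotientAddGroup.induction_on with
    | H x =>
      rw [QuotientAddGroup.map_mk, QuotientAddGroup.eq_zero_iff, AddSubgroup.mem_addSubgroupOf] at hq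
      rw [QuotientAddGroup.eq_zero_iff, AddSubgroup.mem_addSubgroupOf]
      exact hq
  -- (1) `range φ = (range θ)ᶜ`
  have hrange : Set.range φ = (Set.range θ)ᶜ := by
    ext q
    constructor
    · rintro ⟨u, rfl⟩ ⟨q', hq'⟩
      induction q' using QuotientAddGroup.induction_on with
      | H x =>
        rw [QuotientAddGroup.map_mk] at hq'
        change (QuotientAddGroup.mk (ι x) : A ⧸ C.addSubgroupOf A) = QuotientAddGroup.mk ⟨(u : Kˣ), hmemA u u.2⟩ at hq'
        rw [QuotientAddGroup.eq, AddSubgroup.mem_addSubgroupOf] at hq'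
        -- `-x + u ∈ C ⊆ A'` and `x ∈ A'` ⇒ `u ∈ A'`
        have hxA' : ((ι x : A) : K) ∈ A' := x.2
        have hu : ((u : Kˣ) : K) ∈ A' := by
          have h := A'.add_mem hxA' (hCA' hq')
          simpa using h
        exact hnotA' u u.2 hu
    · intro hq
      induction q using QuotientAddGroup.induction_on with
      | H a =>
        have haA' : (a : K) ∉ A' := by
          intro ha
          exact hq ⟨QuotientAddGroup.mk ⟨a, ha⟩, by rw [QuotientAddGroup.map_mk]; rfl⟩
        obtain ⟨u, hu, hua⟩ := (hU a).2 ⟨a.2, haA'⟩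
        refine ⟨⟨u, hu⟩, ?_⟩
        change (QuotientAddGroup.mk ⟨(u : K), hmemA u hu⟩ : A ⧸ C.addSubgroupOf A) = QuotientAddGroup.mk a
        congr 1; exact Subtype.ext hua
  -- (2) `Nat.card (range φ) = [U : Un]`: `φ` descends to an injection of `U ⧸ Un`
  have hφ : ∀ u u' : U, φ u = φ u' ↔ u⁻¹ * u' ∈ Un.subgroupOf U := by
    intro u u'
    rw [Subgroup.mem_subgroupOf, hUn]
    change (QuotientAddGroup.mk _ : A ⧸ C.addSubgroupOf A) = QuotientAddGroup.mk _ ↔ _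
    rw [QuotientAddGroup.eq, AddSubgroup.mem_addSubgroupOf]
    change -((u : Kˣ) : K) + ((u' : Kˣ) : K) ∈ C ↔ _
    have hu0 : ((u : Kˣ) : K) ≠ 0 := (u : Kˣ).ne_zero
    constructor
    · intro h
      refine ⟨Subgroup.mul_mem _ (Subgroup.inv_mem _ u.2) u'.2, ?_⟩
      have h' := hUC _ (Subgroup.inv_mem _ u.2) _ h
      convert h' using 1
      simp only [Subgroup.coe_mul, Subgroup.coe_inv, Units.val_mul, Units.val_inv_eq_inv_val]
      rw [mul_add, mul_neg, inv_mul_cancel₀ hu0]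
      ring
    · rintro ⟨-, h⟩
      have h' := hUC _ u.2 _ h
      convert h' using 1
      simp only [Subgroup.coe_mul, Subgroup.coe_inv, Units.val_mul, Units.val_inv_eq_inv_val]
      rw [mul_sub, ← mul_assoc, mul_inv_cancel₀ hu0, one_mul, mul_one]
      ring
  let φbar : U ⧸ Un.subgroupOf U → Set.range φ :=
    Quotient.lift (fun u => (⟨φ u, u, rfl⟩ : Set.range φ)) (fun a b hab => by
      apply Subtype.ext
      change φ a = φ b
      rw [hφ]
      exact QuotientGroup.leftRel_apply.1 hab)
  have hφbar : Function.Bijective φbar := by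
    constructor
    · intro x y hxy
      induction x using Quotient.inductionOn with
      | h a =>
        induction y using Quotient.inductionOn with
        | h b =>
          have h : φ a = φ b := congrArg Subtype.val hxy
          exact Quotient.sound (QuotientGroup.leftRel_apply.2 ((hφ a b).1 h))
    · rintro ⟨_, u, rfl⟩
      exact ⟨Quotient.mk _ u, rfl⟩
  have hcardU : Nat.card (Set.range φ) = Un.relIndex U := by
    rw [Subgroup.relIndex, Subgroup.index_eq_card]
    exact (Nat.card_congr (Equiv.ofBijective φbar hφbar)).symm
  -- (3) `Nat.card (range θ) = [A' : C ⊓ A']`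
  have hcardA' : Nat.card (Set.range θ) = C.relIndex A' := by
    rw [AddSubgroup.relIndex, AddSubgroup.index_eq_card]
    exact Nat.card_range_of_injective hθinj
  -- (4) count
  have htot : (Set.range θ).ncard + (Set.range θ)ᶜ.ncard = Nat.card (A ⧸ C.addSubgroupOf A) :=
    Set.ncard_add_ncard_compl _
  rw [← hrange, ← Nat.card_coe_set_eq, ← Nat.card_coe_set_eq, hcardA', hcardU, ← AddSubgroup.index_eq_card, add_comm] at htot
  exact htot


end Generic

/-! ## §2 (C3) `[𝒪_E^× : 1 + 𝔭_Eⁿ] = (q − 1)·q^{n−1}` (membership-letter currency for the unit groups) -/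

section Units

variable {K : Type*} [Field K] [Valued K ℤᵐ⁰] {σ : K →+* K} {ϖ : K} {d : ℕ}

/-- `v x ≤ exp a`, `¬ v x ≤ exp (a − 1)` ⇒ `v x = exp a` (discreteness of `ℤᵐ⁰` values). [cite: Serre1979, Ch. II §3] -/
theorem v_eq_exp_of_le_of_not_le {x : K} {a : ℤ} (h1 : Valued.v x ≤ exp a) (h2 : ¬ Valued.v x ≤ exp (a - 1)) : Valued.v x = exp a := by
  have hx0 : Valued.v x ≠ 0 := fun h => h2 (by rw [h]; exact zero_le)
  have hv : Valued.v x = exp (log (Valued.v x)) := (exp_log hx0).symm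
  rw [hv, exp_le_exp] at h1 h2
  rw [hv, exp_inj]
  omega

/-- **(C3), additive form: `[U : U_n] + q^{n−1} = qⁿ`** for `U = {v = 1} ≤ Kˣ`, `U_n = {u ∈ U | v(u − 1) ≤ exp(−n)}`, `n ≥ 1` (any subgroups with these membership letters).
[cite: Serre1979, Ch. IV §2 Prop. 6] -/
theorem relIndex_unitLevel_add_eq (hϖ : Valued.v ϖ = exp (-1 : ℤ)) [Finite 𝓀[K]] {U Un : Subgroup Kˣ}
    (hU : ∀ u : Kˣ, u ∈ U ↔ Valued.v (u : K) = 1) {n : ℕ} (hn : 1 ≤ n)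
    (hUn : ∀ u : Kˣ, u ∈ Un ↔ Valued.v (u : K) = 1 ∧ Valued.v ((u : K) - 1) ≤ exp (-(n : ℤ))) :
    Un.relIndex U + Nat.card 𝓀[K] ^ (n - 1) = Nat.card 𝓀[K] ^ n := by
  set B0 := (Valued.v : Valuation K ℤᵐ⁰).leAddSubgroup (exp (0 : ℤ))
  set B1 := (Valued.v : Valuation K ℤᵐ⁰).leAddSubgroup (exp (-1 : ℤ))
  set Bn := (Valued.v : Valuation K ℤᵐ⁰).leAddSubgroup (exp (-(n : ℤ)))
  have hfinq : Bn.relIndex B0 = Nat.card 𝓀[K] ^ n := by rw [relIndex_leAddSubgroup_exp hϖ]; congr 1; omega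
  have h1n : Bn.relIndex B1 = Nat.card 𝓀[K] ^ (n - 1) := by rw [relIndex_leAddSubgroup_exp hϖ]; congr 1; omega
  rw [← h1n, ← hfinq]
  refine relIndex_add_relIndex_eq_of_units B0 B1 Bn (Valuation.leAddSubgroup_monotone _ (exp_le_exp.2 (by omega)))
    (Valuation.leAddSubgroup_monotone _ (exp_le_exp.2 (by norm_num))) U Un (fun x => ?_) (fun u => ?_) (fun u hu x hx => ?_) ?_
  · -- `(∃ u ∈ U, ↑u = x) ↔ v x ≤ 1 ∧ ¬ v x ≤ exp(−1)`
    constructor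
    · rintro ⟨u, hu, rfl⟩
      rw [hU] at hu
      refine ⟨by rw [Valuation.mem_leAddSubgroup_iff, hu, exp_zero], fun h => ?_⟩
      rw [Valuation.mem_leAddSubgroup_iff, hu, ← exp_zero, exp_le_exp] at h
      omega
    · rintro ⟨hx, hx'⟩
      rw [Valuation.mem_leAddSubgroup_iff] at hx hx'
      have hvx : Valued.v x = 1 := by rw [← exp_zero]; exact v_eq_exp_of_le_of_not_le hx (by simpa using hx')
      have hx0 : x ≠ 0 := fun h => by rw [h, map_zero] at hvx; exact zero_ne_one hvx
      exact ⟨Units.mk0 x hx0, (hU _).2 hvx, rfl⟩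
  · rw [hUn, hU, Valuation.mem_leAddSubgroup_iff]
  · rw [Valuation.mem_leAddSubgroup_iff] at hx ⊢
    rw [map_mul, (hU u).1 hu, one_mul]; exact hx
  · rw [hfinq]; exact pow_ne_zero _ Nat.card_pos.ne'

/-- **(C3) `[𝒪_E^× : 1 + 𝔭_Eⁿ] = (q − 1)·q^{n−1}`** (`n ≥ 1`; membership letters `u ∈ U ↔ v u = 1`, `u ∈ U_n ↔ v u = 1 ∧ v(u − 1) ≤ exp(−n)`): `U∕U¹ ≅ 𝓀^×`, `Uⁱ∕Uⁱ⁺¹ ≅ 𝓀`.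
The number of unit residue classes mod `𝔭ⁿ` is the same number (the classes of `𝒪∕𝔭ⁿ` off `𝔭∕𝔭ⁿ`). [cite: Serre1979, Ch. IV §2 Prop. 6] -/
theorem relIndex_unitLevel_eq (hϖ : Valued.v ϖ = exp (-1 : ℤ)) [Finite 𝓀[K]] {U Un : Subgroup Kˣ}
    (hU : ∀ u : Kˣ, u ∈ U ↔ Valued.v (u : K) = 1) {n : ℕ} (hn : 1 ≤ n)
    (hUn : ∀ u : Kˣ, u ∈ Un ↔ Valued.v (u : K) = 1 ∧ Valued.v ((u : K) - 1) ≤ exp (-(n : ℤ))) :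
    Un.relIndex U = (Nat.card 𝓀[K] - 1) * Nat.card 𝓀[K] ^ (n - 1) := by
  have h := relIndex_unitLevel_add_eq hϖ hU hn hUn
  have hq : 1 ≤ Nat.card 𝓀[K] := Nat.card_pos
  obtain ⟨m, hm⟩ : ∃ m, n = m + 1 := ⟨n - 1, by omega⟩
  subst hm
  rw [Nat.add_sub_cancel] at h ⊢
  rw [pow_succ] at h
  have : Un.relIndex U = Nat.card 𝓀[K] ^ m * Nat.card 𝓀[K] - Nat.card 𝓀[K] ^ m := by omega
  rw [this, Nat.sub_mul, one_mul, mul_comm]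

end Units

/-! ## §3 (C4) `[𝒪_F^× : 𝒪_F^× ∩ (1 + 𝔭_Eⁿ)] = (q − 1)·q^{⌈n∕2⌉ − 1}` -/

section FixedUnits

variable {K : Type*} [Field K] [Valued K ℤᵐ⁰] {σ : K →+* K} {ϖ : K} {d : ℕ}

/-- `[B_F(−2) : B_F(−n)] = q^{⌈n∕2⌉ − 1}` for `n ≥ 1` (shift ★ FILE 1 once by `π₀ = ϖσϖ`; at `n = 1`, `B_F(−1) = B_F(−2)`). [cite: Serre1979, Ch. II §3 Prop. 5; Ch. I §6 Prop. 18] -/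
theorem relIndex_fixedBall_neg_two_eq_pow (hσ : ∀ x, σ (σ x) = x) (hvσ : ∀ a, Valued.v (σ a) = Valued.v a)
    (hfix : ∀ x : K, σ x = x → x ≠ 0 → ∃ n : ℤ, Valued.v x = exp (2 * n)) (hϖ : Valued.v ϖ = exp (-1 : ℤ))
    (hd : Valued.v (ϖ - σ ϖ) = Valued.v ϖ ^ d) [Finite 𝓀[K]] {n : ℕ} (hn : 1 ≤ n) :
    ((Valued.v : Valuation K ℤᵐ⁰).leAddSubgroup (exp (-(n : ℤ))) ⊓ (σ.toAddMonoidHom - AddMonoidHom.id K).ker).relIndex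
        ((Valued.v : Valuation K ℤᵐ⁰).leAddSubgroup (exp (-2 : ℤ)) ⊓ (σ.toAddMonoidHom - AddMonoidHom.id K).ker) = Nat.card 𝓀[K] ^ ((n + 1) / 2 - 1) := by
  set Fx := (σ.toAddMonoidHom - AddMonoidHom.id K).ker
  rcases Nat.lt_or_ge n 2 with h1 | h2
  · -- `n = 1`: `B_F(−1) = B_F(−2)`
    have hn1 : n = 1 := by omega
    subst hn1
    rw [show ((Valued.v : Valuation K ℤᵐ⁰).leAddSubgroup (exp (-((1 : ℕ) : ℤ))) ⊓ Fx) =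
        (Valued.v : Valuation K ℤᵐ⁰).leAddSubgroup (exp (-2 : ℤ)) ⊓ Fx from by
          rw [show (-((1 : ℕ) : ℤ)) = -1 by norm_num]; exact fixedBall_neg_one_eq hfix,
      AddSubgroup.relIndex_self]
    norm_num
  · -- `n ≥ 2`: shift `[B_F(−(n−2)) : B_F(0)]` by `π₀`, `|π₀| = exp(−2)`
    have hc : Valued.v (ϖ * σ ϖ) = exp (-(2 : ℤ)) := by rw [map_mul, hvσ, hϖ, ← exp_add]; norm_num
    have hσc : σ (ϖ * σ ϖ) = ϖ * σ ϖ := by rw [map_mul, hσ, mul_comm]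
    have hcF : ∀ x ∈ Fx, ϖ * σ ϖ * x ∈ Fx := fun x hx => by
      rw [mem_fixedSubgroup_iff] at hx ⊢; rw [map_mul, hσc, hx]
    have hcF' : ∀ x ∈ Fx, (ϖ * σ ϖ)⁻¹ * x ∈ Fx := fun x hx => by
      rw [mem_fixedSubgroup_iff] at hx ⊢; rw [map_mul, map_inv₀, hσc, hx]
    obtain ⟨m, rfl⟩ : ∃ m, n = m + 2 := ⟨n - 2, by omega⟩
    have h := relIndex_leAddSubgroup_inf_shift Fx hc hcF hcF' (-((m + 2 : ℕ) : ℤ)) (-2)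
    rw [show (-((m + 2 : ℕ) : ℤ)) + 2 = -((m : ℤ)) by push_cast; ring, show (-2 : ℤ) + 2 = 0 by norm_num] at h
    rw [← h, relIndex_fixedBall_eq_pow hσ hvσ hfix hϖ hd m]
    congr 1; omega

/-- **(C4), additive form: `[U_F : U_{F,n}] + q^{⌈n∕2⌉−1} = q^{⌈n∕2⌉}`** for the `σ`-FIXED units `U_F = {σ u = u ∧ v u = 1}` and `U_{F,n} = {u ∈ U_F | v(u − 1) ≤ exp(−n)}`, `n ≥ 1`
(membership letters). [cite: Serre1979, Ch. IV §2 Prop. 6; Ch. I §6 Prop. 18] -/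
theorem relIndex_fixedUnitLevel_add_eq (hσ : ∀ x, σ (σ x) = x) (hvσ : ∀ a, Valued.v (σ a) = Valued.v a)
    (hfix : ∀ x : K, σ x = x → x ≠ 0 → ∃ n : ℤ, Valued.v x = exp (2 * n)) (hϖ : Valued.v ϖ = exp (-1 : ℤ))
    (hd : Valued.v (ϖ - σ ϖ) = Valued.v ϖ ^ d) [Finite 𝓀[K]] {U Un : Subgroup Kˣ}
    (hU : ∀ u : Kˣ, u ∈ U ↔ σ u = u ∧ Valued.v (u : K) = 1) {n : ℕ} (hn : 1 ≤ n)
    (hUn : ∀ u : Kˣ, u ∈ Un ↔ (σ u = u ∧ Valued.v (u : K) = 1) ∧ Valued.v ((u : K) - 1) ≤ exp (-(n : ℤ))) :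
    Un.relIndex U + Nat.card 𝓀[K] ^ ((n + 1) / 2 - 1) = Nat.card 𝓀[K] ^ ((n + 1) / 2) := by
  set Fx := (σ.toAddMonoidHom - AddMonoidHom.id K).ker
  set A := (Valued.v : Valuation K ℤᵐ⁰).leAddSubgroup (exp (0 : ℤ)) ⊓ Fx
  set A' := (Valued.v : Valuation K ℤᵐ⁰).leAddSubgroup (exp (-2 : ℤ)) ⊓ Fx
  set C := (Valued.v : Valuation K ℤᵐ⁰).leAddSubgroup (exp (-(n : ℤ))) ⊓ Fx
  have hCA : C.relIndex A = Nat.card 𝓀[K] ^ ((n + 1) / 2) := relIndex_fixedBall_eq_pow hσ hvσ hfix hϖ hd n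
  have hCA' : C.relIndex A' = Nat.card 𝓀[K] ^ ((n + 1) / 2 - 1) := relIndex_fixedBall_neg_two_eq_pow hσ hvσ hfix hϖ hd hn
  rw [← hCA', ← hCA]
  have hC1 : C ≤ (Valued.v : Valuation K ℤᵐ⁰).leAddSubgroup (exp (-1 : ℤ)) ⊓ Fx :=
    inf_le_inf_right _ (Valuation.leAddSubgroup_monotone _ (exp_le_exp.2 (by omega)))
  refine relIndex_add_relIndex_eq_of_units A A' C (hC1.trans (fixedBall_neg_one_eq hfix).le)
    (inf_le_inf_right _ (Valuation.leAddSubgroup_monotone _ (exp_le_exp.2 (by norm_num)))) U Un (fun x => ?_) (fun u => ?_) (fun u hu x hx => ?_) ?_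
  · -- `(∃ u ∈ U, ↑u = x) ↔ x ∈ B_F(0) ∧ x ∉ B_F(−2)`
    constructor
    · rintro ⟨u, hu, rfl⟩
      rw [hU] at hu
      refine ⟨AddSubgroup.mem_inf.2 ⟨by rw [Valuation.mem_leAddSubgroup_iff, hu.2, exp_zero], (mem_fixedSubgroup_iff _).2 hu.1⟩, fun h => ?_⟩
      have h' := (AddSubgroup.mem_inf.1 h).1
      rw [Valuation.mem_leAddSubgroup_iff, hu.2, ← exp_zero, exp_le_exp] at h'
      omega
    · rintro ⟨hx, hx'⟩
      obtain ⟨hx0, hσx⟩ := AddSubgroup.mem_inf.1 hx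
      rw [Valuation.mem_leAddSubgroup_iff, exp_zero] at hx0
      rw [mem_fixedSubgroup_iff] at hσx
      have hxne : x ≠ 0 := by
        rintro rfl
        exact hx' (AddSubgroup.mem_inf.2 ⟨by rw [Valuation.mem_leAddSubgroup_iff, map_zero]; exact zero_le, AddSubgroup.zero_mem _⟩)
      have hvx : Valued.v x = 1 := by
        obtain ⟨m, hm⟩ := hfix x hσx hxne
        have hle : ¬ Valued.v x ≤ exp (-2 : ℤ) := fun h =>
          hx' (AddSubgroup.mem_inf.2 ⟨by rw [Valuation.mem_leAddSubgroup_iff]; exact h, (mem_fixedSubgroup_iff _).2 hσx⟩)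
        rw [hm, ← exp_zero, exp_le_exp] at hx0
        rw [hm, exp_le_exp] at hle
        rw [hm, ← exp_zero, exp_inj]
        omega
      exact ⟨Units.mk0 x hxne, (hU _).2 ⟨hσx, hvx⟩, rfl⟩
  · rw [hUn, hU, AddSubgroup.mem_inf, Valuation.mem_leAddSubgroup_iff, mem_fixedSubgroup_iff]
    constructor
    · rintro ⟨⟨hσu, hvu⟩, hle⟩
      exact ⟨⟨hσu, hvu⟩, hle, by rw [map_sub, map_one, hσu]⟩
    · rintro ⟨⟨hσu, hvu⟩, hle, -⟩
      exact ⟨⟨hσu, hvu⟩, hle⟩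
  · obtain ⟨hσu, hvu⟩ := (hU u).1 hu
    obtain ⟨hxv, hσx⟩ := AddSubgroup.mem_inf.1 hx
    rw [Valuation.mem_leAddSubgroup_iff] at hxv
    rw [mem_fixedSubgroup_iff] at hσx
    refine AddSubgroup.mem_inf.2 ⟨?_, (mem_fixedSubgroup_iff _).2 (by rw [map_mul, hσu, hσx])⟩
    rw [Valuation.mem_leAddSubgroup_iff, map_mul, hvu, one_mul]; exact hxv
  · rw [hCA]; exact pow_ne_zero _ Nat.card_pos.ne'

/-- **(C4) `[𝒪_F^× : 𝒪_F^× ∩ (1 + 𝔭_Eⁿ)] = (q − 1)·q^{⌈n∕2⌉ − 1}`** (`n ≥ 1`; `⌈n∕2⌉ = (n + 1) ∕ 2` in `ℕ`; membership letters as above): the `σ`-fixed units filter through the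
fixed balls, whose steps are `q` every two levels (the residue field of `F` is `𝓀`, `𝔭_F = 𝔭_E² ∩ F`). [cite: Serre1979, Ch. IV §2 Prop. 6; Ch. I §6 Prop. 18] -/
theorem relIndex_fixedUnitLevel_eq (hσ : ∀ x, σ (σ x) = x) (hvσ : ∀ a, Valued.v (σ a) = Valued.v a)
    (hfix : ∀ x : K, σ x = x → x ≠ 0 → ∃ n : ℤ, Valued.v x = exp (2 * n)) (hϖ : Valued.v ϖ = exp (-1 : ℤ))
    (hd : Valued.v (ϖ - σ ϖ) = Valued.v ϖ ^ d) [Finite 𝓀[K]] {U Un : Subgroup Kˣ}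
    (hU : ∀ u : Kˣ, u ∈ U ↔ σ u = u ∧ Valued.v (u : K) = 1) {n : ℕ} (hn : 1 ≤ n)
    (hUn : ∀ u : Kˣ, u ∈ Un ↔ (σ u = u ∧ Valued.v (u : K) = 1) ∧ Valued.v ((u : K) - 1) ≤ exp (-(n : ℤ))) :
    Un.relIndex U = (Nat.card 𝓀[K] - 1) * Nat.card 𝓀[K] ^ ((n + 1) / 2 - 1) := by
  have h := relIndex_fixedUnitLevel_add_eq hσ hvσ hfix hϖ hd hU hn hUn
  have hq : 1 ≤ Nat.card 𝓀[K] := Nat.card_pos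
  obtain ⟨m, hm⟩ : ∃ m, (n + 1) / 2 = m + 1 := ⟨(n + 1) / 2 - 1, by omega⟩
  rw [hm, Nat.add_sub_cancel] at h ⊢
  rw [pow_succ] at h
  have : Un.relIndex U = Nat.card 𝓀[K] ^ m * Nat.card 𝓀[K] - Nat.card 𝓀[K] ^ m := by omega
  rw [this, Nat.sub_mul, one_mul, mul_comm]

end FixedUnits

/-! ## §4 (C5) Fibre uniformity: the fibres of `𝒪∕𝔭^N → 𝒪∕𝔭ⁿ` have `[B(−n) : B(−N)] = q^{N−n}` elements -/

section Fibres

variable {K : Type*} [Field K] [Valued K ℤᵐ⁰] {ϖ : K}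

/-- **(C5) `[𝔭ⁿ : 𝔭^N] = q^{N−n}`** (`n ≤ N`): every fibre of the reduction `𝒪∕𝔭^N → 𝒪∕𝔭ⁿ` is a coset of `𝔭ⁿ∕𝔭^N`; over a UNIT class mod `𝔭ⁿ` (`n ≥ 1`) the whole fibre consists of units, and
multiplication by a fixed unit `κ` permutes classes — so «`ζ ↦ κζ mod 𝔭ⁿ` from unit classes mod `𝔭^N` is `q^{N−n}`-to-one» (SPEC-StageB §A (C5)). [cite: Serre1979, Ch. II §3 Prop. 5] -/
theorem relIndex_ball_ball_eq_pow (hϖ : Valued.v ϖ = exp (-1 : ℤ)) [Finite 𝓀[K]] {n N : ℕ} (hnN : n ≤ N) :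
    ((Valued.v : Valuation K ℤᵐ⁰).leAddSubgroup (exp (-(N : ℤ)))).relIndex ((Valued.v : Valuation K ℤᵐ⁰).leAddSubgroup (exp (-(n : ℤ)))) =
      Nat.card 𝓀[K] ^ (N - n) := by
  rw [relIndex_leAddSubgroup_exp hϖ]; congr 1; omega

end Fibres

end Literature.NumberTheory.LocalFields.WildQuadraticDatum
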